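import Mathlib

/-!
# Definability gap, ROAD P: the sparse-subfamily lemma (N1 proof plan v2, step (c))

Deterministic core of step (c) of the existence proof for few-bad loadable row assignments
(NODE-v7 §H, lens-5 g7).  A *line* (a crowded row or column of a curve's minor, or its pivot
column) has cells indexed by a finite set `L`; cell `j` carries a finite KILLER SET `K j` of
co-curves, and a co-curve lies in at most two killer sets.  Two tools:

* **Averaging over `s`-subsets.**  For a nonnegative pair weight `ω`, some `s`-subset `J ⊆ L`
  has internal pair weight at most the average:
  `pairWeight ω J · C(n, s) ≤ C(n − 2, s − 2) · pairWeight ω L`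
  (`exists_powersetCard_pairWeight_le`),
  via the exact double count `sum_powersetCard_pairWeight` and the pair-containment count
  `card_powersetCard_filter_pair`.
* **Free cells versus private-free cells.**  If every killer lies in at most two of the killer
  sets of `J`, then the number of cells of `J` that are privately free (no ACTIVE killer outside
  the shared set `shared K J`) exceeds the number of free cells by at most twice the number of
  active shared killers (`card_privFree_le`).  In the probabilistic step the privately-free
  indicators are independent and the active shared killers are few (Bernstein, in tree:
  `Literature.Probability.Moments.bernstein`).

Pure finite combinatorics; no probability here.
-/

namespace Summit.ValiantsHypothesis.ValiantsHypothesis.Theorems.DefinabilityGapSparseSubfamily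

open Finset

variable {α β : Type*} [DecidableEq α] [DecidableEq β]

/-! ## Averaging over `s`-subsets -/

/-- Internal (ordered) pair weight of a finite set. [lens-5 g7] -/
def pairWeight (ω : α → α → ℝ) (J : Finset α) : ℝ :=
  ∑ j ∈ J, ∑ j' ∈ J.erase j, ω j j'

/-- The number of `s`-subsets of `L` containing two given distinct elements is
`C(#L − 2, s − 2)`.
[folklore] -/
theorem card_powersetCard_filter_pair (L : Finset α) {s : ℕ} (hs : 2 ≤ s) {j j' : α}
    (hj : j ∈ L) (hj' : j' ∈ L) (hne : j ≠ j') :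
    ((L.powersetCard s).filter fun J => j ∈ J ∧ j' ∈ J).card =
      (L.card - 2).choose (s - 2) := by
  have hc : ((L.erase j).erase j').card = L.card - 2 := by
    rw [card_erase_of_mem (mem_erase.mpr ⟨hne.symm, hj'⟩), card_erase_of_mem hj]
    omega
  rw [← hc, ← card_powersetCard]
  refine card_nbij' (fun J => (J.erase j).erase j') (fun K => insert j (insert j' K))
    (fun J hJ => ?_) (fun K hK => ?_) (fun J hJ => ?_) (fun K hK => ?_)
  · simp only [mem_coe, mem_filter, mem_powersetCard] at hJ ⊢
    obtain ⟨⟨hJL, hJs⟩, hjJ, hj'J⟩ := hJ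
    have hj'e : j' ∈ J.erase j := mem_erase.mpr ⟨hne.symm, hj'J⟩
    refine ⟨erase_subset_erase _ (erase_subset_erase _ hJL), ?_⟩
    rw [card_erase_of_mem hj'e, card_erase_of_mem hjJ, hJs]
    omega
  · simp only [mem_coe, mem_filter, mem_powersetCard] at hK ⊢
    obtain ⟨hKL, hKs⟩ := hK
    have hj'K : j' ∉ K := fun h => by simpa using hKL h
    have hjK : j ∉ K := fun h => by
      have := hKL h
      simp [hne] at this
    have hjK' : j ∉ insert j' K := by simp [hne, hjK]
    refine ⟨⟨?_, ?_⟩, mem_insert_self _ _, mem_insert_of_mem (mem_insert_self _ _)⟩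
    · intro x hx
      rcases mem_insert.mp hx with rfl | hx
      · exact hj
      rcases mem_insert.mp hx with rfl | hx
      · exact hj'
      exact mem_of_mem_erase (mem_of_mem_erase (hKL hx))
    · rw [card_insert_of_notMem hjK', card_insert_of_notMem hj'K, hKs]
      omega
  · simp only [mem_coe, mem_filter, mem_powersetCard] at hJ
    obtain ⟨-, hjJ, hj'J⟩ := hJ
    have hj'e : j' ∈ J.erase j := mem_erase.mpr ⟨hne.symm, hj'J⟩
    show insert j (insert j' ((J.erase j).erase j')) = J
    rw [insert_erase hj'e, insert_erase hjJ]
  · simp only [mem_coe, mem_powersetCard] at hK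
    obtain ⟨hKL, -⟩ := hK
    have hj'K : j' ∉ K := fun h => by simpa using hKL h
    have hjK : j ∉ K := fun h => by
      have := hKL h
      simp [hne] at this
    have hjK' : j ∉ insert j' K := by simp [hne, hjK]
    show ((insert j (insert j' K)).erase j).erase j' = K
    rw [erase_insert hjK', erase_insert hj'K]

/-- For `J ⊆ L`, the pair weight of `J` written as an indicator sum over `L`. [lens-5 g7] -/
theorem pairWeight_eq_sum_ite (ω : α → α → ℝ) {L J : Finset α} (hJL : J ⊆ L) :
    pairWeight ω J =
      ∑ j ∈ L, ∑ j' ∈ L.erase j, if j ∈ J ∧ j' ∈ J then ω j j' else 0 := by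
  unfold pairWeight
  rw [← sum_subset hJL (fun j _ hj => by simp [hj])]
  refine sum_congr rfl fun j hj => ?_
  rw [← sum_subset (erase_subset_erase j hJL) (fun j' _ hj' => ?_)]
  · refine sum_congr rfl fun j' hj' => ?_
    rw [if_pos ⟨hj, mem_of_mem_erase hj'⟩]
  · have : j' ∉ J := fun h =>
      hj' (mem_erase.mpr ⟨(mem_erase.mp ‹j' ∈ L.erase j›).1, h⟩)
    simp [this]

/-- **Exact double count**: summed over all `s`-subsets `J ⊆ L` (`s ≥ 2`), the internal pair
weight is `C(#L − 2, s − 2)` times the pair weight of `L`. [lens-5 g7] -/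
theorem sum_powersetCard_pairWeight (ω : α → α → ℝ) (L : Finset α) {s : ℕ}
    (hs : 2 ≤ s) :
    ∑ J ∈ L.powersetCard s, pairWeight ω J =
      ((L.card - 2).choose (s - 2) : ℝ) * pairWeight ω L := by
  calc ∑ J ∈ L.powersetCard s, pairWeight ω J
      = ∑ J ∈ L.powersetCard s, ∑ j ∈ L, ∑ j' ∈ L.erase j,
          (if j ∈ J ∧ j' ∈ J then ω j j' else 0) :=
        sum_congr rfl fun J hJ => pairWeight_eq_sum_ite ω (mem_powersetCard.mp hJ).1
    _ = ∑ j ∈ L, ∑ j' ∈ L.erase j, ∑ J ∈ L.powersetCard s,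
          (if j ∈ J ∧ j' ∈ J then ω j j' else 0) := by
        rw [sum_comm]
        exact sum_congr rfl fun j _ => sum_comm
    _ = ∑ j ∈ L, ∑ j' ∈ L.erase j, ((L.card - 2).choose (s - 2) : ℝ) * ω j j' := by
        refine sum_congr rfl fun j hj => sum_congr rfl fun j' hj' => ?_
        have hne : j ≠ j' := fun h => (mem_erase.mp hj').1 h.symm
        rw [sum_ite, sum_const_zero, add_zero, sum_const, nsmul_eq_mul,
          card_powersetCard_filter_pair L hs hj (mem_of_mem_erase hj') hne]
    _ = ((L.card - 2).choose (s - 2) : ℝ) * pairWeight ω L := by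
        unfold pairWeight
        rw [mul_sum]
        exact sum_congr rfl fun j _ => (mul_sum _ _ _).symm

/-- **Sparse subfamily by averaging**: for a nonnegative pair weight and `2 ≤ s ≤ #L`, some
`s`-subset `J ⊆ L` has
`pairWeight ω J · C(#L, s) ≤ C(#L − 2, s − 2) · pairWeight ω L`; since
`C(#L−2, s−2)/C(#L, s) = s(s−1)/(#L(#L−1))`, a subset of density `ρ` inherits only a `ρ²`
fraction of the pair weight. [lens-5 g7] -/
theorem exists_powersetCard_pairWeight_le (ω : α → α → ℝ) (L : Finset α) {s : ℕ}
    (hs : 2 ≤ s) (hsL : s ≤ L.card) :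
    ∃ J ∈ L.powersetCard s,
      pairWeight ω J * ((L.card).choose s : ℝ) ≤
        ((L.card - 2).choose (s - 2) : ℝ) * pairWeight ω L := by
  have hne : (L.powersetCard s).Nonempty := powersetCard_nonempty.mpr hsL
  have hsum : ∑ J ∈ L.powersetCard s, pairWeight ω J ≤
      ∑ J ∈ L.powersetCard s,
        ((L.card - 2).choose (s - 2) : ℝ) * pairWeight ω L / (L.card).choose s := by
    rw [sum_powersetCard_pairWeight ω L hs, sum_const, card_powersetCard, nsmul_eq_mul]
    have hc : ((L.card).choose s : ℝ) ≠ 0 := by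
      exact_mod_cast (Nat.choose_pos hsL).ne'
    rw [mul_div_cancel₀ _ hc]
  obtain ⟨J, hJ, hle⟩ := exists_le_of_sum_le hne hsum
  refine ⟨J, hJ, ?_⟩
  have hc : (0 : ℝ) < (L.card).choose s := by exact_mod_cast Nat.choose_pos hsL
  rwa [le_div_iff₀ hc] at hle

/-- The binomial identity behind the density statement:
`C(n, s) · s · (s − 1) = n · (n − 1) · C(n − 2, s − 2)` for `2 ≤ s ≤ n`.
[folklore] -/
theorem choose_mul_desc (n s : ℕ) (hs : 2 ≤ s) (hsn : s ≤ n) :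
    n.choose s * (s * (s - 1)) = n * (n - 1) * (n - 2).choose (s - 2) := by
  obtain ⟨n, rfl⟩ : ∃ k, n = k + 2 := ⟨n - 2, by omega⟩
  obtain ⟨s, rfl⟩ : ∃ k, s = k + 2 := ⟨s - 2, by omega⟩
  simp only [Nat.add_sub_cancel]
  have h1 : (n + 2).choose (s + 2) * (s + 2) = (n + 2) * (n + 1).choose (s + 1) :=
    (Nat.add_one_mul_choose_eq (n + 1) (s + 1)).symm
  have h2 : (n + 1).choose (s + 1) * (s + 1) = (n + 1) * n.choose s :=
    (Nat.add_one_mul_choose_eq n s).symm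
  have e1 : n + 2 - 1 = n + 1 := rfl
  have e2 : s + 2 - 1 = s + 1 := rfl
  rw [e1, e2]
  calc (n + 2).choose (s + 2) * ((s + 2) * (s + 1))
      = ((n + 2).choose (s + 2) * (s + 2)) * (s + 1) := by ring
    _ = ((n + 2) * (n + 1).choose (s + 1)) * (s + 1) := by rw [h1]
    _ = (n + 2) * ((n + 1).choose (s + 1) * (s + 1)) := by ring
    _ = (n + 2) * ((n + 1) * n.choose s) := by rw [h2]
    _ = (n + 2) * (n + 1) * n.choose s := by ring

/-! ## Free cells versus privately free cells -/

section Free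

variable (K : α → Finset β) (act : α → β → Prop) [∀ j b, Decidable (act j b)]

/-- The killers SHARED within `J`: those lying in the killer sets of two distinct cells of `J`.
[lens-5 g7] -/
def shared (J : Finset α) : Finset β :=
  (J.biUnion K).filter fun b => ∃ j ∈ J, ∃ j' ∈ J, j ≠ j' ∧ b ∈ K j ∧ b ∈ K j'

/-- A cell is FREE when none of its killers is active at it. [lens-5 g7] -/
def free (j : α) : Prop := ∀ b ∈ K j, ¬ act j b

/-- A cell of `J` is PRIVATELY FREE when none of its non-shared killers is active at it.
[lens-5 g7] -/
def privFree (J : Finset α) (j : α) : Prop := ∀ b ∈ K j, b ∉ shared K J → ¬ act j b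

/-- The ACTIVE SHARED killers: shared killers active at some cell of `J` containing them.
[lens-5 g7] -/
def activeShared (J : Finset α) : Finset β :=
  (shared K J).filter fun b => ∃ j ∈ J, b ∈ K j ∧ act j b

/-- Membership in `shared`. -/
theorem mem_shared {J : Finset α} {b : β} :
    b ∈ shared K J ↔ ∃ j ∈ J, ∃ j' ∈ J, j ≠ j' ∧ b ∈ K j ∧ b ∈ K j' := by
  unfold shared
  simp only [mem_filter, mem_biUnion, and_iff_right_iff_imp]
  rintro ⟨j, hj, j', -, -, hb, -⟩
  exact ⟨j, hj, hb⟩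

/-- **Free versus privately free**: if every killer lies in at most two killer sets of cells of
`J`, then `#{j ∈ J | privately free} ≤ #{j ∈ J | free} + 2 · #(active shared killers)`.
[lens-5 g7] -/
theorem card_privFree_le (J : Finset α) [DecidablePred (free K act)]
    [DecidablePred (privFree K act J)]
    (htwo : ∀ b, (J.filter fun j => b ∈ K j).card ≤ 2) :
    (J.filter (privFree K act J)).card ≤
      (J.filter (free K act)).card + 2 * (activeShared K act J).card := by
  classical
  -- a privately free cell that is not free has an active shared killer
  have hcover : J.filter (privFree K act J) ⊆
      J.filter (free K act) ∪
        (activeShared K act J).biUnion fun b => J.filter fun j => b ∈ K j := by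
    intro j hj
    rw [mem_filter] at hj
    obtain ⟨hjJ, hpf⟩ := hj
    by_cases hf : free K act j
    · exact mem_union_left _ (mem_filter.mpr ⟨hjJ, hf⟩)
    · refine mem_union_right _ ?_
      unfold free at hf
      push Not at hf
      obtain ⟨b, hbK, hab⟩ := hf
      have hbs : b ∈ shared K J := by
        by_contra h
        exact hpf b hbK h hab
      exact mem_biUnion.mpr
        ⟨b, mem_filter.mpr ⟨hbs, j, hjJ, hbK, hab⟩, mem_filter.mpr ⟨hjJ, hbK⟩⟩
  calc (J.filter (privFree K act J)).card
      ≤ (J.filter (free K act) ∪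
          (activeShared K act J).biUnion fun b => J.filter fun j => b ∈ K j).card :=
        card_le_card hcover
    _ ≤ (J.filter (free K act)).card +
          ((activeShared K act J).biUnion fun b => J.filter fun j => b ∈ K j).card :=
        card_union_le _ _
    _ ≤ (J.filter (free K act)).card +
          ∑ b ∈ activeShared K act J, (J.filter fun j => b ∈ K j).card := by
        gcongr
        exact card_biUnion_le
    _ ≤ (J.filter (free K act)).card + ∑ _b ∈ activeShared K act J, 2 := by
        gcongr with b _
        exact htwo b
    _ = (J.filter (free K act)).card + 2 * (activeShared K act J).card := by
        rw [sum_const, smul_eq_mul, mul_comm]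

/-- The private killer sets of distinct cells of `J` are disjoint (what makes the privately-free
indicators independent in the probabilistic step). [lens-5 g7] -/
theorem disjoint_private {J : Finset α} {j j' : α} (hj : j ∈ J) (hj' : j' ∈ J)
    (hne : j ≠ j') :
    Disjoint ((K j).filter fun b => b ∉ shared K J)
      ((K j').filter fun b => b ∉ shared K J) := by
  rw [disjoint_left]
  intro b hb hb'
  rw [mem_filter] at hb hb'
  exact hb.2 ((mem_shared K).mpr ⟨j, hj, j', hj', hne, hb.1, hb'.1⟩)

end Free

end Summit.ValiantsHypothesis.ValiantsHypothesis.Theorems.DefinabilityGapSparseSubfamily
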